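import Mathlib
import HarnessLib
import HarnessLib.Audit
import Summits.BirchSwinnertonDyer.Statement
import Literature.NumberTheory.EllipticCurves.BhargavaHo2022.TwoMarkedPoints
import Literature.NumberTheory.EllipticCurves.KatoRankBound
import Literature.NumberTheory.EllipticCurves.Sha
import Literature.NumberTheory.EllipticCurves.PAdicBSD
import Literature.NumberTheory.EllipticCurves.IwasawaLeadingTermOddPrime
import Literature.NumberTheory.EllipticCurves.PadicSigmaOddPrime
import Literature.NumberTheory.EllipticCurves.BSDRankZeroDensity
import Literature.NumberTheory.EllipticCurves.CanonicalPAdicHeight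
import Literature.NumberTheory.EllipticCurves.GaloisAction
import Summits.BirchSwinnertonDyer.Rank2.CountingDoorKernel
import Summits.BirchSwinnertonDyer.Rank1Residual.X1.MuLambdaAlgebra
import Literature.NumberTheory.EllipticCurves.LambdaInvariantCongruenceTransportAtTwo
import Literature.NumberTheory.EllipticCurves.CuspFormLFunction
import Literature.NumberTheory.EllipticCurves.PAdicLFunction
import HarnessLib.Audit.Status.Attr

/-!
Route: CountingDoorF2AtThree

DORMANT since 2026-09-02T04:01:06Z (reconciler: no traction for 5 d (last activity item-evidence-added at 2026-08-28T03:08:22Z); parked, not closed — `ledger route dormant route-BirchSwinnertonDyer-CountingDoorF2AtThree --off` to reacti) — unstaffed, not closed; items shared with open routes are served there. `ledger route dormant <id> --off` reactivates.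

# Route CountingDoorF2AtThree — 3-adic BSD in rank two for a positive proportion of Bhargava–Ho's
F₂, by counting 3-Selmer elements

X = the TWIN-axis rung leaf T-r2 `PAdicBSDRankTwoPositiveProportion` (director-bsd ruling
2026-08-26T01:56:50Z, cell bsd-rank2; D-0056 twin currency, NOT a rung toward `BirchSwinnertonDyer`
and it reads no analytic rank — barrier B1): there is a large subfamily Φ of Bhargava–Ho's family F₂
(elliptic curves over ℚ with two marked points, ordered by height) in which the members whose
globally minimal model M is good ordinary at 3 with rank M(ℚ) = 2, Ш(M)[3^∞] = 0 and ord_{T=0} L₃(f,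
α; T) = 2 for every weight-two newform f of M (the rank clause of Mazur–Tate–Teitelbaum's BSD(3) in
rank two) have positive lower density. It is the target item (rank 0) of this route; `closes`
concludes it BY NAME from three cruxes (I1 3-Selmer average ≤ 36 over large subfamilies of F₂; I2
root number +1 with lower density > 1/6; I4 Schneider non-degeneracy at 3 for 100 % of rank-two
members) through the support items (published inputs at 3, the proved per-member door kernel K1–K4,
generic members, counting bridge). The route is born draft and is re-certified with
`--closes-target` once the leaf is loaded as closer T-r2.
Lean: `∃ Φ : Literature.NumberTheory.EllipticCurves.BhargavaHo2022.CongruenceFamily₂, Φ.IsLarge ∧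
Φ.HasPositiveLowerDensityOn fun a ↦ a.IsMember ∧ ∃ (C : WeierstrassCurve.VariableChange ℚ) (hC : (C
• a.curve).IsGloballyMinimal), @Literature.NumberTheory.EllipticCurves.IsOrdinaryAt (C • a.curve) hC
3 _ ∧ (C • a.curve).mordellWeilRank = 2 ∧ AddCommGroup.primaryComponent (C • a.curve).sha 3 = ⊥ ∧ ∀
⦃N : ℕ⦄ [NeZero N] (f : CuspForm (CongruenceSubgroup.Gamma0 N) 2),
Literature.NumberTheory.EllipticCurves.ModularForms.IsNewformOf (C • a.curve) f →
(Literature.NumberTheory.EllipticCurves.padicLFunction f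
(@Literature.NumberTheory.EllipticCurves.unitRoot (C • a.curve) hC 3 _ : ℚ_[3])).order = 2`

## Assembly
Modus ponens (trivial seam, allowed by the ruling): `closes (hIn : PublishedInputsAtThree) (hK :
DoorKernelAtThree) (h0 : GenericMembersLargeF2) (h1 : SelmerThreeAverageLargeF2) (h2 :
RootNumberPlusLowerDensityLargeF2) (h4 : SchneiderDensityOneAtThree) (hB : CountingBridge) :
PAdicBSDRankTwoPositiveProportion := hB hIn hK h0 h1 h2 h4`; the mathematics sits in
`CountingBridge` (provable now from kernels K1–K5) and `DoorKernelAtThree` (proved, K4). The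
conclusion is the leaf T-r2, not `BirchSwinnertonDyer`: the route is born draft and gets
`--closes-target <leaf FQN>` after the closer list loads it.

CLOSES_TARGET: closes rung T-r2 of BirchSwinnertonDyer: Summit.BirchSwinnertonDyer.BirchSwinnertonDyer.Theses.CountingDoorF2AtThree.PAdicBSDRankTwoPositiveProportion (D-0061; not the summit Statement) — the deciding theorem of this route concludes that registered leaf instead of the Statement decl `BirchSwinnertonDyer` (class rung: servable and labelled, never counted as concluding the summit Statement).

Rationale: WHY THIS LINE. Mechanism (memo PADIC-R2-G8 §3; kernels K1–K4 now TREE THEOREMS in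
`Summits/BirchSwinnertonDyer/Rank2/CountingDoorKernel.lean`, p428808, and the bookkeeping kernel K3
in `Rank2/F2DensityAlgebra.lean`, p422671 + p424917): COUNT instead of CONSTRUCT. In F₂ 100 % of
members have rank ≥ 2 and trivial torsion (BhargavaHo2022 Thm 10.1, tree fact `thm10_1_F2`; transfer
to a large Φ by BH Thm 9.1, fact `thm9_1_F2` filed p430042), so #Sel₃ ≥ 9 throughout, ≥ 27 when the
root number is −1 and ≥ 81 when it is +1 unless #Sel₃ = 9 exactly (Dokchitser–Dokchitser 3-parity in
counting form, fact `even_selmerRank_sub_torsionRank_iff`; tree theorem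
`Rank2.card_selmerGroup_bounds_of_rootNumber`); a first-moment bound avg #Sel₃ ≤ A with A < 27 + 54ρ
(ρ = lower density of root number +1) forces #Sel₃ = 9 on a set of lower density ≥ (27 + 54ρ − A)/72
(tree theorems `Rank2.three_level_counting_inequality`,
`Rank2.hasPositiveLowerDensityOn_of_memberwise_bounds`), and #Sel₃ = 9 with rank ≥ 2 and E[3](ℚ) = 0
gives rank = 2 and Ш[3^∞] = 0 by pure counting (tree theorem
`Rank2.rank_eq_two_and_sha_eq_bot_of_card_selmerGroup_of_irreducible`); then Skinner–Urban's main
conjecture at p = 3 (fact `skinner_urban_main_conjecture`, clause 2 only — char X = (3^k·L₃), enough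
for ord_T; needs ρ̄₃ irreducible and an auxiliary prime ℓ ∥ N with 3 ∤ v_ℓ(Δ_min), both arranged by
congruence conditions that keep the family large: good ordinary at 3 (mod 3), v₅(Δ) = 1 (mod 25),
and if wanted a Frobenius certificate «X² − a_ℓ X + ℓ rootless mod 3» at one auxiliary good prime ℓ,
class-constant) plus Schneider 1985 / Perrin-Riou (`Schneider1985_order_charGenerator_odd`) and the
Mazur–Tate σ at odd good ordinary p INCLUDING 3 (`mazur_tate_sigma_exists_odd`, Mazur–Tate 1991 —
this is what makes `PAdicHeightData.IsCanonical` meaningful at p = 3; the MST06 σ-formula docstring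
«p ≥ 5» is a remark about that paper's algorithm, not about the definition) turn corank 2 +
non-degenerate canonical 3-adic height into ord_T L₃ = 2 (tree theorem `Rank2.doorKernel_at_three` =
item DoorKernelAtThree in substance). Imported area: arithmetic statistics (geometry-of-numbers
Selmer averages, BhargavaShankarTernary2015, BhargavaHo2022, PoonenRains2012 heuristic 3²·(3+1) =
36) married to cyclotomic Iwasawa theory at the descent prime; no analytic-rank input (B1) and no
construction of rank-2 families (every construction door of the cell — GEN 6 R3, GEN 9 door D″ —
died on generic rank 0). What prior routes do not do: all other BSD routes and the negatives index
are ∀-E statements or r ≤ 1 closers; none is a density statement over a thin family, none uses a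
Selmer AVERAGE as a crux.

RANKED CRUXES. STATE AT REV 12 (tenure g13, 2026-08-27, after the close of I4loc): I4loc
`SchneiderOnDoorSubfamily` (stmt-19682, crux rank 4) is CLOSED — proved by
`Summit.BirchSwinnertonDyer.BirchSwinnertonDyer.Theorems.schneiderOnDoorSubfamily` (p463209,
2026-08-26T19:06Z; line valuation-class-at-three: on the explicit large congruence family Φ = F₂ ∩
{a ≡ (7,0,4,0) mod 9} ∩ {(1,0,1,0) mod 25} ∩ {(1,2,4,3) mod 7} ∩ {ℓ² ∤ Δ} the first 3-adic digits of
ĥ₃(2P₁)/3, ĥ₃(3P₂)/3 are congruence invariants and certify Reg₃ ≠ 0 for EVERY member — Schneider at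
3 member-wise, no density-one statement needed), and the localized bridge `CountingBridgeLoc`
(stmt-19683) is CLOSED (eng-2, `countingBridgeLoc`). RE-GLUE AT REV 13 (same tenure pass, on eng-2's
landed `leaf_of_cruxes_without_largeFamilyInputs hIn h1 h2 : PAdicBSDRankTwoPositiveProportion`,
p484012, which discharges the large-family inputs, generic members AND Schneider-at-3 MEMBER-WISE on
a refined explicit door family Φ*** via the kernel-decided reduction homomorphism mod 3·7·13,
p482692/p483480): `closes (hB : CountingBridgeMin) (hIn : PublishedInputsAtThree) (h1 :
SelmerThreeAverageLargeF2) (h2 : RootNumberPlusLowerDensityLargeF2) := hB hIn h1 h2`, where the new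
support #9 `CountingBridgeMin` (stmt-20019: PublishedInputsAtThree → I1 → I2 → leaf) is provable now
by the 3-line file `theorem countingBridgeMin : CountingBridgeMin :=
leaf_of_cruxes_without_largeFamilyInputs`. The OPEN load-bearing cone of `closes` is therefore
exactly: #2 I1 `SelmerThreeAverageLargeF2` (XL, the deciding crux), #3 I2
`RootNumberPlusLowerDensityLargeF2` (XL), the fact pack #9 `PublishedInputsAtThree` (published
theorems, auto-crux by token only) and `CountingBridgeMin` until its 3-line closing file lands;
`LargeFamilyInputsF2` (rev 14), `SchneiderDensityOneAtThree` (former I4) and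
`UnitCoefficientDensityAtFive` are ASIDES (banked context, never staffed); `CountingBridgeLoc` and
`SchneiderOnDoorSubfamily` stay in the file as PROVED items outside the cone. No new statement is
added after this close: the branch below I4loc is empty by design and both remaining cruxes are
single counting theorems whose decomposition waits for a named candidate object (TWO-LAYER PLAN).
Ranking unchanged: I1 (rank 2) before I2 (rank 3). The per-item analysis below is kept as filed;
read #4 as the record of WHY the density-one form was abandoned for I4loc. #0
PAdicBSDRankTwoPositiveProportion (target) — the leaf T-r2 as in § Thesis (positive lower density,
in some large Φ ⊆ F₂, of members with a globally minimal model good ordinary at 3, rank 2, Ш[3^∞] =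
0 and ord_T L₃ = 2 for every newform). (why it might fail: it needs all three cruxes at once on ONE
large family; if avg #Sel₃(F₂) exceeds 27 + 54ρ for every admissible Φ the first-moment door is shut
even if the statement is true.) [BhargavaHo2022, MazurTateTeitelbaum1986Invent, PoonenRains2012]
#2 SelmerThreeAverageLargeF2 (crux) — I1 — for every large subfamily Φ of F₂ the average of
#Sel₃(E_a) over members of height < X is at most 36 + o(1) (Poonen–Rains / BKLPR value 3²·(3+1);
Bhargava–Ho prove the 2-Selmer analogue ≤ 12 = 2²·3 for F₂ and avg #Sel₃(F₁) ≤ 12 for one marked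
point). [difficulty: XL] T5 CEILING-LIFT DECLARED (tribunal T2/J): the printed θ-group /
coregular-orbit method is CAPPED below (F₂, 3) — the coregular θ-parametrisations are classified and
F₂ occurs only with 2-Selmer (Bhargava–Ho 2022 p. 7, §7.1; Bhargava–Shankar arXiv:1306.4424 p. 52;
3⊗3⊗3⊗3 is not coregular, lit LIT-R2 §1r/§1w(b): null for any (F₂,3) parametrisation in corpus +
galaxy); the lift this crux needs is a NON-θ / non-orbit first-moment method for 3-Selmer elements
of curves with two marked points (or a parametrisation by a non-coregular representation with a
workable invariant theory) — that method IS the open content of I1, not an add-on. (why it might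
fail: no orbit parametrisation of 3-Selmer elements of curves with TWO marked points is known; the
relevant representation may fail to be coregular, uniformity/tail estimates may fail, and the true
average could exceed 36 on some large Φ.) [BhargavaHo2022, BhargavaShankarTernary2015,
PoonenRains2012, arXiv:1306.4424]
#3 RootNumberPlusLowerDensityLargeF2 (crux) — I2 — in every large subfamily Φ of F₂ with a nonempty
congruence condition at every prime, the members with global root number +1 have lower density ρ >
1/6. [difficulty: XL (re-labelled from L per tribunal T2: no mechanism in print even for ρ > 0)]
WEAKEST DOOR-NEEDED FORM: ρ(Φ₀) > (A − 27)/54 for ONE large Φ₀ carrying the door's congruence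
conditions, where A is I1's constant (A = 36 ⇒ 1/6; equidistribution predicts 1/2; eng's exact
census kit j251853: Pr(w = +1 ∣ Φ₃) = 49.94 % at H < 10⁹ over 7 271 196 tuples, 52.04 % on Φ₃,₂₅).
The ∀-Φ typing is kept because the only conceivable mechanisms are uniform in Φ: (M1) Chowla-type
cancellation of λ(Δ_{F₂}(a)) over weighted boxes (4 variables, weighted degree 12: open, Helfgott's
binary-form methods do not reach it), (M2) a height-bounded sign-reversing correspondence on a large
subfamily — PROVED ABSENT for the natural candidates (the −1-twist leaves F₂ unless a₁ = a₃ = 0,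
where the 2-torsion is full and the generic rank drops; (a₁,a₃) ↦ (−a₁,−a₃) and a₂ ↔ a₂′ are
isomorphisms), (M3) a sieve-defined positive-density sub-locus with computable sign — none found.
(why it might fail: root-number equidistribution in boxes ordered by height is open (Helfgott:
conditional on Chowla-type cancellation for the degree-12 discriminant form); F₂ has no
height-preserving sign-reversing involution like Bhargava–Shankar's −1-twist on F₀, so even ρ > 0 is
not in print.) [BhargavaShankarTernary2015, arXiv:math/0408141, BhargavaHo2022]
#4 [ASIDE since rev 10; superseded by I4loc SchneiderOnDoorSubfamily, CLOSED rev 12]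
SchneiderDensityOneAtThree — former I4 — in every large subfamily Φ of F₂ (nonempty conditions), for
100 % of members: if a globally minimal model is good ordinary at 3 and has rank 2 then every
CANONICAL 3-adic height datum is non-degenerate (Schneider's conjecture at 3 for density one of the
rank-two members). [difficulty: XL; MATH-BOUND class per J] SOLE CONSUMER: the `order = 2` clause of
the leaf (via K4); rank = 2 ∧ Ш[3^∞] = 0 need only I1 + I2 + K1. CORRECTION of rev 2's two-layer
note (lit LIT-R2 §1w(e), from the tree's own `Schneider1985_order_charGenerator_odd` clause 3): for
a counted member (rank 2, Ш[3^∞] = 0, #E(ℚ)[3] = 1, good ordinary anomalous 3 — EVERY good-ordinary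
F₂ member is anomalous, #Ẽ(𝔽₃) ∈ {3, 6}, eng census) v₃([T²]f_X) = v₃(Reg₃) + v₃(∏c_ℓ) (the
anomalous 3² cancels log₃(γ)²), hence λ₃ = 2 ⟺ v₃(Reg₃·Tam) = 0, which is STRICTLY STRONGER than
Schneider (Reg₃ ≠ 0 ⟺ ord_T f_X = 2); the rev-2 chain «Schneider ⟺ λ = 2 ⟺ #Sel₃(E/ℚ(ζ₉)⁺) = 9»
holds in the direction λ₃ = 2 ⟹ ord_T = 2 ⟹ Schneider only, and exact control at the first layer
fails at the anomalous prime. Data: (λ₃, μ₃) = (2,0) on 44 of 61 small rank-2 good-ordinary members,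
(4,0):11, (6,0):2, (10,0):4 (eng kit j250819, PARI ellpadiclambdamu); v₃(R₃) = 0 on 147 011 / 219
604 = 67 % of L (eng kit j250514). So a λ-certificate (μ₃ = 0 ∧ λ₃ = 2, a finite datum of modular
symbols mod 27, no height evaluated) certifies I4 member-wise on ≈ 2/3 of the counted members — a
positive proportion, NOT density one — and cannot be intersected with the count inside this door; it
defines the sibling door D-λ recorded under NOT DECOMPOSED YET. (why it might fail: no method
controls p-adic regulators in families (global denominators d(mP) enter log₃(σ₃(mP)/d(mP)) and are
not 3-adically continuous in the parameters: no congruence box decides it); Kundu–Ray statistics are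
heuristic; a positive-density degenerate locus is not excluded.) [Schneider1985, MazurSteinTate2006,
arXiv:2104.06015, arXiv:2106.12095, BalakrishnanMuellerSteinBSDp]
#9 GenericMembersLargeF2 (support) — I0 — in every large subfamily Φ of F₂ with nonempty conditions,
100 % of members have trivial rational torsion, rank ≥ 2 and irreducible mod-3 representation.
[difficulty: M] PLAN (lit R1, LIT-R2 §1w(d)): the printed content (torsion = 1 ∧ rank ≥ 2 for 100 %)
is `thm9_1_F2.hasDensityOn_torsionOrder_rank_of_isLarge` (filed with p430042) modulo the two BH
facts; the ρ̄₃-clause for 100 % is true (Hilbert irreducibility; S. D. Cohen 1981 via Serre, Topics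
Thm 3.4.4, uniform over translated cubes by the large sieve) but not in print for F₂ and not in the
tree — when p430042 lands the tenure planner re-types I0 to the fact-antecedent printed form and
moves irreducibility into CountingBridge's Φ₀ as the Frobenius certificate at one auxiliary good
prime (class-constant; tree pattern `IntModel.hasIrreducibleModPGaloisRep_of_intModel_of_noroot`),
one edit, statements of I1/I2/I4 and the leaf untouched. [BhargavaHo2022, Cohen1981Thin, Serre1972]
#9 PublishedInputsAtThree (support) — the published inputs at p = 3, as the conjunction of the
tree's NAMED Literature facts (Schneider 1985 / Perrin-Riou order formula at odd p; Mazur–Tate 1991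
σ at odd good ordinary p, p = 3 included; Dokchitser–Dokchitser 3-parity in counting form;
Skinner–Urban 2014 Thm 3.6.9 at p = 3 for every globally minimal elliptic W, κ, γ, f) — a fact-pack
item (the route closes MODULO it); all four are PUBLISHED THEOREMS: the gate's lexical tag
«kind.auto-crux: conjecture-grade» fires on the tokens `skinner_urban_main_conjecture` /
`SchneiderConjecture` in the inlined bodies, nothing conjectural is asserted (SU clause 3, the
surjectivity-dependent integral equality, is NOT used by K4). [difficulty: fact-pack]
[Schneider1985, MazurTate1991Sigma, DokchitserDokchitserAnnals2010, SkinnerUrban2014]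
#9 DoorKernelAtThree (support) — the per-member door kernel at p = 3: LANDED IN SUBSTANCE as
`Summit.BirchSwinnertonDyer.Rank2.doorKernel_at_three` (p428808, commit 471600f5ebf1; hypotheses =
the three conjuncts of PublishedInputsAtThree by name); the item closes by the 3-line file
`Theorems/CountingDoorKernelAtThree.lean` (`theorem doorKernelAtThree : …DoorKernelAtThree := fun
hIn W _ _ hord hirr haux hR hSel h2 ↦ Rank2.doorKernel_at_three hIn.1 hIn.2.1 hIn.2.2.2 W hord hirr
haux hR hSel h2`, farm rc 0, attached as item evidence by bsd-rank2-lit; any PROVER seat files it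
with `--workitem stmt-BirchSwinnertonDyer-19483` once the route is open). [difficulty: provable-now]
[SkinnerUrban2014, Schneider1985, PerrinRiou1984, Greenberg1999LNM]
#9 CountingBridge (support) — the counting bridge (first-moment method + parity; tree kernels
`three_level_counting_inequality`, `hasPositiveLowerDensityOn_of_memberwise_bounds`,
`hasPositiveLowerDensityOn_and_of_hasDensityOn_one`): the published inputs, the door kernel, generic
members, I1, I2 and I4 imply the leaf — shrink to Φ₀ = {good ordinary at 3} ∩ {v₅(Δ) = 1}
(conditions at 3 and 25: still large, nonempty; eng census: ρ̄₃ irreducible on 100.00 % of Φ₃,₂₅ up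
to 10⁹, haux automatic at ℓ = 5), apply I1/I2/I0/I4 to Φ₀, run the first-moment inequality 36 + ε ≥
9x + 81(ρ − x) + 27(1 − ρ) − o(1) to get x ≥ (54ρ − 9 − ε)/72 > 0, and feed each counted member to
the door kernel; member ↔ minimal-model transfers have short-Weierstrass templates in the tree
(LIT-R2 §1w(d)). [difficulty: M] [BhargavaShankarTernary2015, BhargavaHo2022,
DokchitserDokchitserAnnals2010]

TWO-LAYER PLAN. I1 ⇐ (a) a parametrisation of 3-Selmer elements of F₂-curves — NOT by a coregular
θ-representation (capped, see #2) — by some representation/variety with two relative invariants and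
a workable reduction theory → (b) a geometry-of-numbers or other first-moment count of the
corresponding integral objects of bounded height with the uniformity (tail) estimate → I1; first
lemma as a Lean signature (the INTERFACE a parametrisation must provide: an injection from {(a, σ) :
a ∈ Φ.below X, σ ∈ Sel₃(E_a)} into a counted set of size ≤ 36·#Φ.below X·(1 + o(1))) is drafted in
the cell folder (HOME/p2/g10/) for the first prover. I4 ⇐ no density-one split is known (the rev-2
«second count over ℚ(ζ₉)⁺» is withdrawn as an equivalence, see #4); the member-wise λ-certificate
K-λ («μ₃ = 0 ∧ λ₃(L₃) = 2 ∧ rank ≥ 2 ⟹ rank = corank = ord_T L₃ = 2 ∧ Ш[3^∞] finite ∧ Schneider at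
3», Kato 17.4 + Schneider 1985, no IMC, no height) is the typed first lemma of the sibling door, not
a split of I4.

KILL CRITERIA. Refuted:SelmerThreeAverageLargeF2 with a large Φ of average > 27 + 54·(1/2) = 54
closes the route outright (no first-moment door at p = 3; pivot to p = 5 needs avg #Sel₅ < 5³ + (5⁴
− 5³)ρ — file anew). Refuted:RootNumberPlusLowerDensityLargeF2 by a large nonempty Φ with ρ ≤ 1/6
forces a pivot to the «∃ Φ₀» door-needed form (above) on a hand-built family.
Refuted:SchneiderDensityOneAtThree (a positive-density degenerate locus) kills the ord_T clause:
pivot to the weaker leaf without `order = 2` (rank 2 ∧ Ш[3^∞] = 0 for a positive proportion; needs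
I1 + I2 + K1, no Iwasawa theory), or to the sibling λ-count door D-λ (one statistical crux Λ2 «μ₃ =
0 ∧ λ₃ = 2 on a positive-lower-density subset of a large Φ», which gives rank = ord_T L₃ = 2 ∧
Ш[3^∞] finite WITHOUT parity, IMC or Schneider, and Ш[3] = 0 only with IMC + v₃(Reg₃) ≥ 0). A proof
of the p-adic BSD rank clause for all E (route PAdicOrderV2 crux #3) moots the ord_T part.

NOT DECOMPOSED YET. The parametrisation behind I1 (layer 2, only once a candidate object is named);
the re-typing of I0 to its printed fact-antecedent form (waits for p430042); the positive density of
large families inside F₂ (BH Thm 9.1 / Prop 9.2, fact `thm9_1_F2`) used by I0 and by the bridge; the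
bookkeeping that intersecting a large family with conditions at 3, 25 (and one auxiliary Frobenius
prime) stays large with nonempty residues (inside CountingBridge's proof). RECORDED SIBLING (not an
item of this route): door D-λ with the single crux Λ2 above and kernel K-λ; its numerical witness is
eng kit j250819 (λ₃ = 2 on 44/61 = 72 % of small rank-2 good-ordinary members) — to be opened only
on a director ruling about the leaf variant «Ш[3^∞] finite».

CHEAPEST FALSIFIER. ONE kit job (eng, asked by the judge): avg #Sel₃ (3-descent bounds / ellrank +
analytic Ш) over Φ₃,₂₅ = generic ∧ good ordinary at 3 ∧ v₅(Δ) = 1 in nested height balls up to 10⁷: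
an empirical average heading far above 36 retires I1 as typed; the other two instruments are RUN
(eng kit j251853, exact census of all 939 371 canonical members with H < 10⁹): Pr(w = +1 ∣ Φ₃) =
49.94 % (threshold 27 + 54ρ = 54.0 vs A = 36, slack 18) and 52.04 % on Φ₃,₂₅; avg #Sel₂ ∣ Φ₃ = 8.379
at 10⁹ (rising toward BH's 12); Reg₃ ≠ 0 certified for every one of the 606 117 generic
good-ordinary anchors (19 395 Schneider instances with H < 10⁷, kit j249707–j250329, j251848) —
consistent with I2 and I4, deciding nothing.

NUMBERS. A = 36 = 3²(3+1) (Poonen–Rains average of #Sel_p with two marked points: p^{#points}·(p+1);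
checks: BH avg Sel₂(F₁) ≤ 6, Sel₃(F₁) ≤ 12, Sel₂(F₂) ≤ 12). Door threshold A < 27 + 54ρ ⟺ ρ > (A −
27)/54: with ρ = 1/2, A < 54 (slack 18); with A = 36, ρ > 1/6. Lower density delivered: x ≥ (27 +
54ρ − A)/72 = 1/4 at (36, 1/2), before removing the density-0 exceptional sets. General p: threshold
ρ > (A − p³)/(p⁴ − p³) with A = p²(p + 1): p = 2 ⇒ 1/2 (dead tie), p = 3 ⇒ 1/6, p = 5 ⇒ 1/20. λ data
at 3: (2,0) ×44, (4,0) ×11, (6,0) ×2, (10,0) ×4 of 61 (j250819); λ₃ ≡ ord_T ≡ 0 (mod 2) as the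
functional equation predicts.

DEFINITION REQUESTS. None: F₂ vocabulary landed (p418517 `BhargavaHo2022/TwoMarkedPoints.lean`);
canonical height `PAdicHeightData.IsCanonical` (CanonicalPAdicHeight.lean; meaningful at p = 3
through `mazur_tate_sigma_exists_odd`); large-family count `thm9_1_F2` filed (p430042, lit); BH Thm
1.1/1.2 (Selmer averages of F₀/F₁/F₂, I1's sibling rungs) asked of bsd-rank2-lit as named facts in
the same module.

Novelty: Searches (2026-08-26): lit search --hybrid "average size 3-Selmer two marked points" (0 relevant
beyond BhargavaHo2022), lit vsearch "positive proportion of elliptic curves satisfy p-adic BSD /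
have rank two and trivial Sha" (textbook hits only: Silverman, CSS, Delbourgo, DD2010), lit galaxy
search "rank 2|rank two" / "3-Selmer|three-descent|3-isogeny descent" / "Tate-Shafarevich group is
finite" --star all (noise, 0 family-wise rank-2 results), lean search 'HasPositiveLowerDensityOn' /
'selmerGroup 3' (no item of this shape among 40 BSD routes), ledger negatives --problem
BirchSwinnertonDyer (no density statement refuted).
Nearest prior art found: BhargavaHo2022 (avg Sel₂(F₂) ≤ 12, 100 % rank ≥ 2 — Thm 1.1/10.1),
BhargavaShankarTernary2015 + arXiv:1306.4424 (first-moment + parity ⇒ positive proportion rank 0 /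
rank 1 and BSD for them, r ≤ 1 only), BKLOS arXiv-1709.09790 (positive proportion of rank 0/1
satisfy BSD), Kundu–Ray arXiv:2104.06015 (statistics of λ = rank, heuristic in rank ≥ 1).
Delta: the first route anywhere that makes a rank-TWO BSD-type statement (3-adic BSD rank clause +
Ш[3^∞] = 0) a consequence of a Selmer AVERAGE over a family where rank ≥ 2 is generic, with the
Iwasawa prime equal to the descent prime so that counting replaces both construction and analytic
rank.
Claimed grade: new-combination  [refs: 1306.4424, 2104.06015, BhargavaHo2022, BhargavaShankarTernary2015]

Barriers (technique_class: arithmetic-statistics, selmer-average, cyclotomic-IMC): - technique_class: arithmetic-statistics, selmer-average, cyclotomic-IMC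
- Literature.Barriers.BirchSwinnertonDyer.HeegnerPointBarrier: outside its class — no Heegner point
/ Euler-system construction; the two independent points are the marked points of F₂ and Ш[3^∞] = 0
comes from the count #Sel₃ = 9, not from Kolyvagin.
- Literature.Barriers.BirchSwinnertonDyer.FunctionalEquationSeesOnlyParity: respected — the root
number is used ONLY for parity (Dokchitser–Dokchitser 3-parity, fact
even_selmerRank_sub_torsionRank_iff); "= 2" comes from the Selmer count, never from the functional
equation.
- Literature.Barriers.BirchSwinnertonDyer.NumericalVanishingBarrier: evaded — nothing analytic or
numerical is certified; ord_T L₃ = 2 is read off the algebraic side through the main conjecture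
(cell barrier B1 honoured: the leaf is TWIN-axis, no r_an).
- Literature.Barriers.BirchSwinnertonDyer.ExceptionalZeroBarrier: outside — p = 3 is good ordinary
for every counted member (congruence condition at 3); no split-multiplicative exceptional zero.
- Literature.Barriers.BirchSwinnertonDyer.PAdicHeightBarrier: I4 (SchneiderDensityOneAtThree) sits
INSIDE this class and requires beating it head-on — I4 IS Schneider's non-degeneracy conjecture
(Mazur–Stein–Tate 2006 Conj. 1.1; Delbourgo 2008 §2.1 «still an open question») for the canonical
cyclotomic 3-adic height, asked for density one of the rank-two good-ordinary members of a large
family; it is DECLARED as crux stmt-19442 (rank 4, why-might-f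

History (route lifecycle, newest last):
- 2026-08-26T05:44:50Z · rev 1: dropped PublishedInputsAtThree, DoorKernelAtThree, CountingBridge — cone repair: inline the cite_only fact bodies into PublishedInputsAtThree; DoorKernelAtThree + CountingBridge dropped/re-added verbatim only to keep render orde (planner-bsd-rank2-p2-g9-0)
- 2026-08-26T08:32:53Z · rev 4: informal re-worded for RootNumberPlusLowerDensityLargeF2, SchneiderDensityOneAtThree, DoorKernelAtThree, GenericMembersLargeF2, PublishedInputsAtThree (planner-bsd-rank2-p2-g10-0)
- 2026-08-26T08:33:04Z · AUTO-CRUX (edit): PublishedInputsAtThree — hypotheses of the deciding theorem that nothing in the route derives are cruxes (planner-bsd-rank2-p2-g10-0)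
- 2026-08-26T09:03:09Z · closes_target -> closes rung T-r2 of BirchSwinnertonDyer: Summit.BirchSwinnertonDyer.BirchSwinnertonDyer.Theses.CountingDoorF2AtThree.PAdicBSDRankTwoPositiveProportion (D-0061; not the summit Statement) (planner-bsd-rank2-p2-g10-0)
- 2026-08-26T09:22:16Z · rev 6: dropped GenericMembersLargeF2, CountingBridge — R1 (tenure, after p430042 thm9_1_F2 landed): support I0 GenericMembersLargeF2 re-typed to its printed fact-antecedent form (BH22 Thm 10.1 + Thm 9.1; the rho-bar (planner-bsd-rank2-p2-g10-0)
- 2026-08-26T11:34:19Z · rev 8: restated Assembly (stmt-BirchSwinnertonDyer-19447) — tenure g11: restate Assembly to carry the two fact packs as hypotheses (eng g5 finding 10:15:49Z, director concur 10:38:20Z); closes and cruxes I1/I2/I4 untouch (planner-bsd-rank2-p2-g11-0)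
- 2026-08-26T11:34:53Z · AUTO-CRUX (edit): PublishedInputsAtThree — hypotheses of the deciding theorem that nothing in the route derives are cruxes (planner-bsd-rank2-p2-g11-0)
- 2026-09-02T04:01:06Z · DORMANT — reconciler: no traction for 5 d (last activity item-evidence-added at 2026-08-28T03:08:22Z); parked, not closed — `ledger route dormant route-BirchSwinnertonDye (operator:999:95742)

sub-problem: BirchSwinnertonDyer · status: dormant · opened planner-bsd-rank2-p2-g9-0 2026-08-26T05:28:51Z · rev 18 · ledger route-BirchSwinnertonDyer-CountingDoorF2AtThree
GENERATED by the gate from the ledger (D-0016/17). Provers cite these decls: `theorem foo : Summit.BirchSwinnertonDyer.BirchSwinnertonDyer.Theses.CountingDoorF2AtThree.<Decl> := …` in Summits/BirchSwinnertonDyer/BirchSwinnertonDyer/Theorems/<Name>.lean.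
-/

namespace Summit.BirchSwinnertonDyer.BirchSwinnertonDyer.Theses.CountingDoorF2AtThree

open scoped BigOperators Topology Manifold Classical MeasureTheory ProbabilityTheory Matrix InnerProductSpace ComplexConjugate ContinuousMap
open Filter Set Function TopologicalSpace MeasureTheory

attribute [summit_statement] _root_.BirchSwinnertonDyer
-- H21.Audit: the closer leaf Summit.BirchSwinnertonDyer.BirchSwinnertonDyer.Theses.CountingDoorF2AtThree.PAdicBSDRankTwoPositiveProportion is an item decl of this route file — tagged summit_statement below, after its declaration

open Literature

/-- item stmt-BirchSwinnertonDyer-19439 · target · rank 0 · open · by planner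
why it might fail: it needs I1, I2 and I4 at once on ONE large family; if avg #Sel₃ exceeds 27 + 54ρ on every admissible Φ the first-moment door is shut even if the statement is true; the `order = 2` clause additionally needs Schneider for density one.
sources: BhargavaHo2022, MazurTateTeitelbaum1986Invent, PoonenRains2012
[target] the leaf T-r2 as in § Thesis (positive lower density, in some large Φ ⊆ F₂, of members with
a globally minimal model good ordinary at 3, rank 2, Ш[3^∞] = 0 and ord_T L₃ = 2 for every newform). -/
@[route_item "route-BirchSwinnertonDyer-CountingDoorF2AtThree"]
def PAdicBSDRankTwoPositiveProportion : Prop :=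
  ∃ Φ : Literature.NumberTheory.EllipticCurves.BhargavaHo2022.CongruenceFamily₂, Φ.IsLarge ∧ Φ.HasPositiveLowerDensityOn fun a ↦ a.IsMember ∧ ∃ (C : WeierstrassCurve.VariableChange ℚ) (hC : (C • a.curve).IsGloballyMinimal), @Literature.NumberTheory.EllipticCurves.IsOrdinaryAt (C • a.curve) hC 3 _ ∧ (C • a.curve).mordellWeilRank = 2 ∧ AddCommGroup.primaryComponent (C • a.curve).sha 3 = ⊥ ∧ ∀ ⦃N : ℕ⦄ [NeZero N] (f : CuspForm (CongruenceSubgroup.Gamma0 N) 2), Literature.NumberTheory.EllipticCurves.ModularForms.IsNewformOf (C • a.curve) f → (Literature.NumberTheory.EllipticCurves.padicLFunction f (@Literature.NumberTheory.EllipticCurves.unitRoot (C • a.curve) hC 3 _ : ℚ_[3])).order = 2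

/-- item stmt-BirchSwinnertonDyer-19440 · crux · rank 2 · open · by planner
why it might fail: no 3-Selmer parametrisation for curves with TWO marked points exists: coregular θ-representations are classified and F₂ occurs only with 2-Selmer (BH22 p7, BS 1306.4424 p52); a non-coregular one may have no reduction theory, tails may fail, and the true average may exceed 36 on some large Φ.
sources: BhargavaHo2022, BhargavaShankarTernary2015, PoonenRains2012, arXiv:1306.4424
[crux] I1 — for every large subfamily Φ of F₂ the average of #Sel₃(E_a) over members of height < X
is at most 36 + o(1) (Poonen–Rains / BKLPR value 3²·(3+1) for two marked points; Bhargava–Ho prove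
the 2-Selmer analogue ≤ 12 = 2²·3 and, for one marked point, avg #Sel₃(F₁) ≤ 12). [difficulty: XL] -/
@[route_item "route-BirchSwinnertonDyer-CountingDoorF2AtThree", crux]
def SelmerThreeAverageLargeF2 : Prop :=
  ∀ Φ : Literature.NumberTheory.EllipticCurves.BhargavaHo2022.CongruenceFamily₂, Φ.IsLarge → Φ.AverageOnLE (fun a ↦ (Nat.card (a.curve.selmerGroup 3) : ℝ)) 36

/-- item stmt-BirchSwinnertonDyer-19441 · crux · rank 3 · open · by planner
why it might fail: root-number equidistribution in height boxes is open (Chowla-type cancellation for the 4-variable weighted-degree-12 form Δ_{F₂}); F₂ has no height-bounded sign-reversing correspondence (−1-twist leaves F₂ unless a₁ = a₃ = 0), so even ρ > 0 on one large Φ is not in print.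
sources: BhargavaShankarTernary2015, arXiv:math/0408141, BhargavaHo2022
[crux] I2 — in every large subfamily Φ of F₂ with a nonempty congruence condition at every prime,
the members with global root number +1 have lower density ρ > 1/6. [difficulty: XL] Weakest
door-needed form: ρ(Φ₀) > (A − 27)/54 for ONE large Φ₀ carrying the door's congruence conditions (A
= I1's constant; A = 36 ⇒ 1/6; equidistribution predicts 1/2; exact census kit j251853: 49.94 % at H
< 10⁹ on Φ₃). Conceivable mechanisms, all uniform in Φ, none in print: Chowla-type cancellation for
the weighted-degree-12 discriminant form in 4 variables; a height-bounded sign-reversing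
correspondence (absent: the −1-twist leaves F₂ unless a₁ = a₃ = 0); a sieve-defined positive-density
sub-locus with computable sign (none found). Sources: BhargavaShankarTernary2015 (−1-twist
involution on F₀), Helfgott arXiv:math/0408141, BhargavaHo2022. -/
@[route_item "route-BirchSwinnertonDyer-CountingDoorF2AtThree", crux]
def RootNumberPlusLowerDensityLargeF2 : Prop :=
  ∀ Φ : Literature.NumberTheory.EllipticCurves.BhargavaHo2022.CongruenceFamily₂, Φ.IsLarge → (∀ p : ℕ, p.Prime → (Φ.residues p).Nonempty) → ∃ ρ : ℝ, 1 / 6 < ρ ∧ Φ.DensityOnGE (fun a ↦ a.curve.rootNumber = 1) ρ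

/-- item stmt-BirchSwinnertonDyer-19482 · crux (kind.auto-crux: conjecture-grade) · rank 9 · open · by planner
why it might fail: none of the four conjuncts is open; residual risk = transcription scope only (SU Thm 3.6.9 hypotheses: ρ̄₃ irreducible + an auxiliary prime ℓ ∥ N with ρ̄₃ ramified — both carried as hypotheses of DoorKernelAtThree, not assumed away).
sources: Schneider1985, MazurTate1991Sigma, DokchitserDokchitserAnnals2010, SkinnerUrban2014
[support, fact-pack] The published inputs at p = 3 as the conjunction of the tree's NAMED Literature
facts: Schneider1985_order_charGenerator_odd (Schneider 1985 / Perrin-Riou, as printed in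
Balakrishnan–Müller–Stein Thm 1.7, p > 2) ∧ mazur_tate_sigma_exists_odd (Mazur–Tate 1991: the
canonical σ and height exist at every odd good ordinary p, p = 3 INCLUDED — this is what makes
PAdicHeightData.IsCanonical meaningful at 3; the «p ≥ 5» in the MST06 σ-docstring concerns that
paper's algorithm) ∧ even_selmerRank_sub_torsionRank_iff (Dokchitser–Dokchitser 2010, 3-parity in
counting form) ∧ ∀ W κ γ f, skinner_urban_main_conjecture W 3 … (Skinner–Urban 2014 Thm 3.6.9; only
clause 2, char X = (3^k·L₃), is consumed). All four are published theorems; the gate's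
«kind.auto-crux: conjecture-grade» tag is lexical (tokens `main_conjecture`, `SchneiderConjecture`
occur in the bodies). The route closes MODULO this item. [difficulty: fact-pack] -/
@[route_item "route-BirchSwinnertonDyer-CountingDoorF2AtThree", crux]
def PublishedInputsAtThree : Prop :=
  (∀ (W : WeierstrassCurve ℚ) [W.IsElliptic] [W.IsGloballyMinimal] (p : ℕ) [Fact p.Prime], p ≠ 2 → W.HasGoodReductionAtPrime p → ¬ (p : ℤ) ∣ W.frobeniusTrace p → ∀ (κ : Literature.NumberTheory.EllipticCurves.ZpExtension ℚ p) (γ : Field.absoluteGaloisGroup ℚ), κ.IsCyclotomic → κ.IsTopGenerator γ → Literature.NumberTheory.EllipticCurves.IsCyclotomicVariable p γ → ∀ (D : W.SelmerDualData κ γ) [Module.Finite (Literature.NumberTheory.EllipticCurves.IwasawaAlgebra p) D.X], D.IsTorsion → ∀ (fE : Literature.NumberTheory.EllipticCurves.IwasawaAlgebra p), D.charIdeal = Ideal.span {fE} → ∀ (Dh : W.PAdicHeightData p), Dh.IsCanonical → (W.mordellWeilRank : ℕ∞) ≤ fE.order ∧ (fE.order = W.mordellWeilRank ↔ (WeierstrassCurve.SchneiderConjecture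 Dh ∧ Finite (AddCommGroup.primaryComponent W.sha p))) ∧ (WeierstrassCurve.SchneiderConjecture Dh → Finite (AddCommGroup.primaryComponent W.sha p) → ∃ u : ℤ_[p]ˣ, ((PowerSeries.coeff W.mordellWeilRank fE : ℤ_[p]) : ℚ_[p]) * Literature.NumberTheory.EllipticCurves.padicLog p (Literature.NumberTheory.EllipticCurves.cyclotomicGenerator p) ^ W.mordellWeilRank * (W.torsionOrder : ℚ_[p]) ^ 2 = ((u : ℤ_[p]) : ℚ_[p]) * ((1 - (Literature.NumberTheory.EllipticCurves.unitRoot W p : ℚ_[p])⁻¹) ^ 2 * ((Nat.card (AddCommGroup.primaryComponent W.sha p) : ℚ_[p]) * WeierstrassCurve.padicRegulator Dh * W.tamagawaProduct)))) ∧ (∀ (W : WeierstrassCurve ℚ) [W.IsElliptic] [W.IsGloballyMinimal] (p : ℕ) [Fact p.Prime], p ≠ 2 → W.HasGoodReductionAtPrime p → ¬ (p : ℤ) ∣ W.frobeniusTrace p → ∃ σ : PowerSeries ℚ_[p], ∃ c : ℚ_[p], (W.baseChange ℚ_[p]).IsMazurTateSigmaPair σ c) ∧ (∀ (W : WeierstrassCurve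 ℚ) [W.IsElliptic] (p : ℕ) [Fact p.Prime] (s t : ℕ), Nat.card (W.selmerGroup p) = p ^ s → Nat.card (AddSubgroup.torsionBy W.toAffine.Point (p : ℤ)) = p ^ t → (Even ((s : ℤ) - t) ↔ W.rootNumber = 1)) ∧ ∀ (W : WeierstrassCurve ℚ) [W.IsElliptic] [W.IsGloballyMinimal] (κ : Literature.NumberTheory.EllipticCurves.ZpExtension ℚ 3) (γ : Field.absoluteGaloisGroup ℚ) {N : ℕ} [NeZero N] (f : CuspForm (CongruenceSubgroup.Gamma0 N) 2), Literature.NumberTheory.EllipticCurves.skinner_urban_main_conjecture W 3 (κ := κ) (γ := γ) (f := f)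

/-- item stmt-BirchSwinnertonDyer-19442 · aside · rank 4 · open · by planner
why it might fail: Schneider non-degeneracy at 3 for density one of rank-2 members of EVERY large Φ: no family-level transcendence/valuation argument reaches all large Φ uniformly; anomalous classes with v₃(ψ₆(P_i)) ≥ 2 for all members defeat first-digit methods
sources: MazurSteinTate2006, Schneider1982PadicHeightI, zbl:1106.11023
[crux] I4 — in every large subfamily Φ of F₂ (nonempty conditions), for 100 % of members: if a
globally minimal model is good ordinary at 3 and has rank 2 then every CANONICAL 3-adic height datum
(Mazur–Tate σ, meaningful at p = 3 via mazur_tate_sigma_exists_odd) is non-degenerate — Schneider's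
conjecture at 3 for density one of the rank-two members. [difficulty: XL; inside
Literature.Barriers.BirchSwinnertonDyer.PAdicHeightBarrier, declared] Sole consumer: the leaf's
`order = 2` clause (K4); rank = 2 ∧ Ш[3^∞] = 0 do not use it. Member-wise certificate (one direction
only): μ₃(L₃) = 0 ∧ λ₃(L₃) = 2 ⟹ ord_T L₃ = ord_T f_X = rank = 2 ⟹ Schneider at 3 (Kato 17.4 +
Schneider 1985 clause 2); on counted members v₃([T²]f_X) = v₃(Reg₃) + v₃(∏c_ℓ) (every good-ordinary
F₂ member is anomalous at 3, the 3² cancels log₃(γ)²), so λ₃ = 2 is strictly stronger than Schneider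
and holds on ≈ 2/3 of them (eng kit j250819: (λ₃,μ₃) = (2,0) on 44/61), not density one. Sources:
Schneider1985, MazurSteinTate2006 Conj 1.1, Kundu–Ray arXiv:2104.06015 / arXiv:2106.12095 (heuristic
statistics of λ = rank), BalakrishnanMuellerSteinBSDp. -/
@[route_item "route-BirchSwinnertonDyer-CountingDoorF2AtThree"]
def SchneiderDensityOneAtThree : Prop :=
  ∀ Φ : Literature.NumberTheory.EllipticCurves.BhargavaHo2022.CongruenceFamily₂, Φ.IsLarge → (∀ p : ℕ, p.Prime → (Φ.residues p).Nonempty) → Φ.HasDensityOn (fun a ↦ ∀ (C : WeierstrassCurve.VariableChange ℚ) (hC : (C • a.curve).IsGloballyMinimal), @Literature.NumberTheory.EllipticCurves.IsOrdinaryAt (C • a.curve) hC 3 _ → (C • a.curve).mordellWeilRank = 2 → ∀ Dh : WeierstrassCurve.PAdicHeightData (C • a.curve) 3, Dh.IsCanonical → WeierstrassCurve.SchneiderConjecture Dh) 1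

/-- item stmt-BirchSwinnertonDyer-19682 · banked · rank 4 · closed · proved by Summit.BirchSwinnertonDyer.BirchSwinnertonDyer.Theorems.schneiderOnDoorSubfamily (prover) · by planner
why it might fail: no residue class mod 3^k inside the door class may realise a deciding first-digit pattern with v₃(ψ₆(P_i;a)) = 1 for both marked points, or the exact-denominator input den x(6Q) = ψ₆(Q)² fails off the squarefree sieve; the fallback (Lipschitz + certified value) needs Katz E₂-analyticity at 3
sources: MazurSteinTate2006, MazurTate1991, BhargavaHo2022, arXiv:math/0404412, zbl:1106.11023
[crux] I4loc — ONE large congruence subfamily Φ of F₂ with nonempty residue sets whose members all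
satisfy the local door conditions of Theorems.leaf_of_local (ρ̄₃ irreducible; every globally minimal
model ordinary at 3 with a Skinner–Urban auxiliary multiplicative prime ℓ ≠ 3, 3 ∤ v_ℓ(Δ_min)) and
in which Schneider non-degeneracy at 3 holds for a density-one set of members (every canonical datum
on every globally minimal good-ordinary model of Mordell–Weil rank 2) — exactly the hSchD input of
leaf_of_local. Strictly weaker than I4 ∧ (door family exists) (SketchG11.i4loc_of_i4). Line of
record: valuation class at 3 (HOME/p2/PADIC-R2-G11.md §2): first 3-adic digits of ĥ₃(6P_i) are
congruence invariants of a; digit product a non-residue mod 3 forces Reg₃(P₁,P₂) ≠ 0 for every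
member. why it might fail: no residue class mod 3^k inside the door class may realise a deciding
digit pattern with v₃(ψ₆(P_i;a)) = 1 for both marked points, or the exact-denominator input den
x(6Q) = ψ₆(Q)² fails off the squarefree sieve; fallback Lipschitz + certified value needs Katz
E₂-analyticity at 3. sources: MazurSteinTate2006 Thm 1.3/§2, MazurTate1991 Thm 3.1, BhargavaHo2022
Thm 9.1, arXiv:math/0404412, -/
@[route_item "route-BirchSwinnertonDyer-CountingDoorF2AtThree"]
def SchneiderOnDoorSubfamily : Prop :=
  ∃ Φ : Literature.NumberTheory.EllipticCurves.BhargavaHo2022.CongruenceFamily₂, Φ.IsLarge ∧ (∀ p : ℕ, p.Prime → (Φ.residues p).Nonempty) ∧ (∀ a : Literature.NumberTheory.EllipticCurves.BhargavaHo2022.Params, Φ.Mem a → a.curve.HasIrreducibleModPGaloisRep 3 ∧ ∀ (C : WeierstrassCurve.VariableChange ℚ) (hC : (C • a.curve).IsGloballyMinimal), @Literature.NumberTheory.EllipticCurves.IsOrdinaryAt (C • a.curve) hC 3 _ ∧ ∃ ℓ : ℕ, ∃ _ : Fact ℓ.Prime, ℓ ≠ 3 ∧ (C • a.curve).HasMultiplicativeReductionAtPrime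 ℓ ∧ ¬ 3 ∣ padicValInt ℓ (@WeierstrassCurve.minimalDiscriminantInt (C • a.curve) hC)) ∧ Φ.HasDensityOn (fun a ↦ ∀ (C : WeierstrassCurve.VariableChange ℚ) (hC : (C • a.curve).IsGloballyMinimal), @Literature.NumberTheory.EllipticCurves.IsOrdinaryAt (C • a.curve) hC 3 _ → (C • a.curve).mordellWeilRank = 2 → ∀ Dh : WeierstrassCurve.PAdicHeightData (C • a.curve) 3, Dh.IsCanonical → WeierstrassCurve.SchneiderConjecture Dh) 1

-- `SchneiderOnDoorSubfamily` holds: proved by `Summit.BirchSwinnertonDyer.BirchSwinnertonDyer.Theorems.schneiderOnDoorSubfamily` (its module imports this route file, so no `_holds` link can be stated here).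

/-- item stmt-BirchSwinnertonDyer-20286 · aside · rank 4 · open · by planner
why it might fail: p = 2, E[2] reducible: no Ihara/canonical-period control (multiplicity one at the Eisenstein ideal can fail); a pair in different 2-division fields or a 17a-like mu-jump could break it. Falsifier j272856: 42/42 type-B curves (22 fields, N <= 600) consistent; type A untested.
sources: Matsuno2008, GreenbergVatsal2000, Vatsal1999, MazurTateTeitelbaum1986Invent, arXiv:2412.07308, kit:j272856
[crux] for globally minimal elliptic W, W′ good ordinary at 2 with unique rational 2-torsion points
x, x′ of the same Greenberg type, newforms f, f′ of W, W′ (any levels), and nonzero integral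
rational multiples L₀, L₀′ of L₂(f, α_W), L₂(f′, α_W′): lam L₀ + Σ_S(W) = lam L₀′ + Σ_S(W′), S =
primeFactors(N_W·N_W′). [difficulty: XL] -/
@[route_item "route-BirchSwinnertonDyer-CountingDoorF2AtThree"]
def AnalyticMatsunoTwinAtTwo : Prop :=
  ∀ (W W' : WeierstrassCurve ℚ) [W.IsElliptic] [W.IsGloballyMinimal] [W'.IsElliptic] [W'.IsGloballyMinimal] (x x' : ℚ), Literature.NumberTheory.EllipticCurves.IsOrdinaryAt W 2 → Literature.NumberTheory.EllipticCurves.IsOrdinaryAt W' 2 → Literature.NumberTheory.EllipticCurves.HasUniqueRationalTwoTorsionX W x → Literature.NumberTheory.EllipticCurves.HasUniqueRationalTwoTorsionX W' x' → Literature.NumberTheory.EllipticCurves.SameGreenbergTypeAB W x W' x' → ∀ ⦃N : ℕ⦄ [NeZero N] (f : CuspForm (CongruenceSubgroup.Gamma0 N) 2) ⦃N' : ℕ⦄ [NeZero N'] (f' : CuspForm (CongruenceSubgroup.Gamma0 N') 2), Literature.NumberTheory.EllipticCurves.ModularForms.IsNewformOf W f → Literature.NumberTheory.EllipticCurves.ModularForms.IsNewformOf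 W' f' → ∀ (c c' : ℚ) (L₀ L₀' : Literature.NumberTheory.EllipticCurves.IwasawaAlgebra 2), L₀ ≠ 0 → L₀' ≠ 0 → Literature.NumberTheory.EllipticCurves.iwasawaToPowerSeries 2 L₀ = PowerSeries.C (c : ℚ_[2]) * Literature.NumberTheory.EllipticCurves.padicLFunction f (Literature.NumberTheory.EllipticCurves.unitRoot W 2 : ℚ_[2]) → Literature.NumberTheory.EllipticCurves.iwasawaToPowerSeries 2 L₀' = PowerSeries.C (c' : ℚ_[2]) * Literature.NumberTheory.EllipticCurves.padicLFunction f' (Literature.NumberTheory.EllipticCurves.unitRoot W' 2 : ℚ_[2]) → Summit.BirchSwinnertonDyer.Rank1Residual.X1.MuLambda.lam L₀ + Literature.NumberTheory.EllipticCurves.matsunoSigmaShiftAtTwo W (W.conductorNorm ℤ * W'.conductorNorm ℤ).primeFactors = Summit.BirchSwinnertonDyer.Rank1Residual.X1.MuLambda.lam L₀' + Literature.NumberTheory.EllipticCurves.matsunoSigmaShiftAtTwo W' (W.conductorNorm ℤ * W'.conductorNorm ℤ).primeFactors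

/-- item stmt-BirchSwinnertonDyer-19483 · support · rank 9 · closed · proved by Summit.BirchSwinnertonDyer.BirchSwinnertonDyer.Theorems.doorKernelAtThree (prover) · by planner
sources: SkinnerUrban2014, Schneider1985, PerrinRiou1984, Greenberg1999LNM
[support] The per-member door kernel at p = 3: PublishedInputsAtThree → for every globally minimal
elliptic W good ordinary at 3 with ρ̄₃ irreducible, an auxiliary prime ℓ ∥ N with 3 ∤ v_ℓ(Δ),
#Sel₃(W) = 9 and rank ≥ 2: rank = 2 ∧ Ш[3^∞] = 0 ∧ ord_T L₃(f) = 2 for every newform f of W. LANDED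
IN SUBSTANCE as Summit.BirchSwinnertonDyer.Rank2.doorKernel_at_three (p428808); closes by the 3-line
file Theorems/CountingDoorKernelAtThree.lean `theorem doorKernelAtThree : DoorKernelAtThree := fun
hIn W _ _ hord hirr haux hR hSel h2 ↦ Rank2.doorKernel_at_three hIn.1 hIn.2.1 hIn.2.2.2 W hord hirr
haux hR hSel h2` (draft attached as item evidence, farm rc 0; prover-only target class).
[difficulty: provable-now] -/
@[route_item "route-BirchSwinnertonDyer-CountingDoorF2AtThree"]
def DoorKernelAtThree : Prop :=
  PublishedInputsAtThree → ∀ (W : WeierstrassCurve ℚ) [W.IsElliptic] [W.IsGloballyMinimal], Literature.NumberTheory.EllipticCurves.IsOrdinaryAt W 3 → W.HasIrreducibleModPGaloisRep 3 → (∃ ℓ : ℕ, ∃ _ : Fact ℓ.Prime, ℓ ≠ 3 ∧ W.HasMultiplicativeReductionAtPrime ℓ ∧ ¬ 3 ∣ padicValInt ℓ W.minimalDiscriminantInt) → (∀ Dh : WeierstrassCurve.PAdicHeightData W 3, Dh.IsCanonical → WeierstrassCurve.SchneiderConjecture Dh) → Nat.card (W.selmerGroup 3) = 3 ^ 2 →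 2 ≤ W.mordellWeilRank → W.mordellWeilRank = 2 ∧ AddCommGroup.primaryComponent W.sha 3 = ⊥ ∧ ∀ ⦃N : ℕ⦄ [NeZero N] (f : CuspForm (CongruenceSubgroup.Gamma0 N) 2), Literature.NumberTheory.EllipticCurves.ModularForms.IsNewformOf W f → (Literature.NumberTheory.EllipticCurves.padicLFunction f (Literature.NumberTheory.EllipticCurves.unitRoot W 3 : ℚ_[3])).order = 2

-- `DoorKernelAtThree` holds: proved by `Summit.BirchSwinnertonDyer.BirchSwinnertonDyer.Theorems.doorKernelAtThree` (its module imports this route file, so no `_holds` link can be stated here).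

/-- item stmt-BirchSwinnertonDyer-19549 · aside · rank 9 · open · by planner
why it might fail: published theorems (BH22 Thm 9.1/10.1); fails only if the transcription of the height/vocabulary in TwoMarkedPoints.lean mis-states them
sources: BhargavaHo2022
[support] FACT PACK for the large-family count, INLINED: the conjunction of the bodies of the named
Literature facts `Literature.NumberTheory.EllipticCurves.BhargavaHo2022.thm10_1_F2` (Bhargava–Ho
2022 Thm 10.1, p. 35: in F₂ ordered by height, trivial rational torsion for 100 % and rank ≥ 2 for
100 %) and `…thm9_1_F2` (Thm 9.1, p. 31 with §8.2, Prop 9.2, Thm 9.6: every large Φ ⊆ F₂ with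
nonempty residues has #Φ(<X)/X^{2/3} → c_Φ > 0). `LargeFamilyInputsF2 ↔ thm10_1_F2 ∧ thm9_1_F2` is
`Iff.rfl` (folder/SketchR1.lean). Same status as PublishedInputsAtThree: the route closes MODULO
these published inputs; discharged only by citing the facts (not a crux). -/
@[route_item "route-BirchSwinnertonDyer-CountingDoorF2AtThree", crux]
def LargeFamilyInputsF2 : Prop :=
  (Literature.NumberTheory.EllipticCurves.BhargavaHo2022.CongruenceFamily₂.all.HasDensityOn (fun a ↦ a.curve.torsionOrder = 1) 1 ∧ Literature.NumberTheory.EllipticCurves.BhargavaHo2022.CongruenceFamily₂.all.HasDensityOn (fun a ↦ 2 ≤ a.curve.mordellWeilRank) 1) ∧ ∀ Φ : Literature.NumberTheory.EllipticCurves.BhargavaHo2022.CongruenceFamily₂, Φ.IsLarge → (∀ p : ℕ, p.Prime → (Φ.residues p).Nonempty) → ∃ c : ℝ, 0 < c ∧ Filter.Tendsto (fun X : ℕ ↦ ((Φ.below X).card : ℝ) / (X : ℝ) ^ ((2 : ℝ) / 3)) Filter.atTop (nhds c)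

/-- item stmt-BirchSwinnertonDyer-19550 · support · rank 9 · closed · proved by Summit.BirchSwinnertonDyer.BirchSwinnertonDyer.Theorems.genericMembersLargeF2 (prover) · by planner
why it might fail: cannot: one-line consequence of the landed corollary thm9_1_F2.hasDensityOn_torsionOrder_rank_of_isLarge (p430042)
sources: BhargavaHo2022
[support] I0 re-typed (R1, rev 6) to its PRINTED strength: modulo the large-family facts (antecedent
`LargeFamilyInputsF2`), in every large Φ ⊆ F₂ with nonempty residues the members with trivial
rational torsion and rank ≥ 2 have density 1 — relative density bookkeeping (a density-0 subset of
F₂ has density 0 in Φ because #Φ(<X) ≍ #F₂(<X) by Thm 9.1). PROOF IS ONE LINE: `fun hL ↦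
Literature.NumberTheory.EllipticCurves.BhargavaHo2022.thm9_1_F2.hasDensityOn_torsionOrder_rank_of_isLarge
hL.2 hL.1` (p430042; checked in folder/SketchR1.lean) — file it as
Theorems/CountingDoorF2AtThreeGenericMembers.lean. The former ρ̄₃-irreducibility clause is gone: the
bridge certifies irreducibility for EVERY member of its Φ₀ from one Frobenius class (mod-7
condition, F2DoorClasses), which is stronger where it is needed and costs no thin-set theorem.
[difficulty: provable-now] -/
@[route_item "route-BirchSwinnertonDyer-CountingDoorF2AtThree"]
def GenericMembersLargeF2 : Prop :=
  LargeFamilyInputsF2 → ∀ Φ : Literature.NumberTheory.EllipticCurves.BhargavaHo2022.CongruenceFamily₂, Φ.IsLarge → (∀ p : ℕ, p.Prime → (Φ.residues p).Nonempty) → Φ.HasDensityOn (fun a ↦ a.curve.torsionOrder = 1 ∧ 2 ≤ a.curve.mordellWeilRank) 1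

-- `GenericMembersLargeF2` holds: proved by `Summit.BirchSwinnertonDyer.BirchSwinnertonDyer.Theorems.genericMembersLargeF2` (its module imports this route file, so no `_holds` link can be stated here).

/-- item stmt-BirchSwinnertonDyer-19551 · support · rank 9 · closed · proved by Summit.BirchSwinnertonDyer.BirchSwinnertonDyer.Theorems.countingBridge (prover) · by planner
why it might fail: bookkeeping only: fails if the density algebra lemmas (F2DensityAlgebra/AE) do not cover the «bounds on a density-one Good set» case — they do (p422671, p424917; AE file pending)
sources: BhargavaShankarTernary2015, BhargavaHo2022, DokchitserDokchitserAnnals2010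
[support] the counting bridge (first-moment method + parity; R1 threading, rev 6): the published
inputs at 3, the large-family facts, the door kernel (CLOSED: Theorems.doorKernelAtThree), generic
members, I1, I2 and I4 imply the leaf. RECIPE (every name a tree decl; lit 08:37Z): Φ₀ := conditions
{a ≡ (1,0,1,0) mod 3} (good ordinary at 3), {a ≡ (1,0,1,0) mod 25} (5 ∥ N, v₅(Δ) = 1: the SU
auxiliary prime), {a ≡ (1,2,4,3) mod 7} (Frobenius at 7 with characteristic polynomial irreducible
mod 3 ⇒ ρ̄₃ irreducible for every member) — large (p₀ = 8), residues nonempty; Good := «torsionOrder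
= 1 ∧ 2 ≤ rank» from `h0 hL Φ₀ hΦ₀ hne` (density 1) ∧ I4's Schneider set (density 1);
`Rank2.hasPositiveLowerDensityOn_of_memberwise_bounds_on` with f = #Sel₃(a.curve), W = (w = +1), G =
(#Sel₃ = 9), constants (9, 27, 81), A = 36 (h1 Φ₀), ρ > 1/6 (h2 Φ₀), member-wise bounds K2
`Rank2.card_selmerGroup_bounds_of_rootNumber` +
`pow_mordellWeilRank_mul_card_torsionBy_le_card_selmerGroup`; threshold 36 < 27 + 54ρ ⟸ ρ > 1/6
gives lower density ≥ (54ρ − 9)/72 > 0 of counted members; per counted member: C from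
`hasGlobalMinimalModel_rat_holds`, K1 `Rank2.rank_eq_two_and_sha_eq_bot_of_card_selmerGroup_rat`,
tran -/
@[route_item "route-BirchSwinnertonDyer-CountingDoorF2AtThree"]
def CountingBridge : Prop :=
  PublishedInputsAtThree → LargeFamilyInputsF2 → DoorKernelAtThree → GenericMembersLargeF2 → SelmerThreeAverageLargeF2 → RootNumberPlusLowerDensityLargeF2 → SchneiderDensityOneAtThree → PAdicBSDRankTwoPositiveProportion

-- `CountingBridge` holds: proved by `Summit.BirchSwinnertonDyer.BirchSwinnertonDyer.Theorems.countingBridge` (its module imports this route file, so no `_holds` link can be stated here).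

/-- item stmt-BirchSwinnertonDyer-19683 · support · rank 9 · closed · proved by Summit.BirchSwinnertonDyer.BirchSwinnertonDyer.Theorems.countingBridgeLoc (prover) · by planner
[support] CountingBridgeLoc — the localized counting bridge: the published inputs at 3, the
large-family facts, generic members, I1, I2 and I4loc (SchneiderOnDoorSubfamily) imply the leaf; ≈30
lines from Theorems.leaf_of_local (eng p436628), whose hypotheses hloc / hGen / hA / hW / hρ / hAρ /
hSchD are I4loc’s conjuncts, GenericMembersLargeF2, I1 (A = 36), I2 (ρ > 1/6, 36 < 27 + 54ρ). why it
might fail: bookkeeping only — fails if I2’s DensityOnGE is stated on a predicate leaf_of_local does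
not accept verbatim (it is: rootNumber = 1). sources: BhargavaHo2022, tree
Summit.BirchSwinnertonDyer.BirchSwinnertonDyer.Theorems.leaf_of_local -/
@[route_item "route-BirchSwinnertonDyer-CountingDoorF2AtThree"]
def CountingBridgeLoc : Prop :=
  PublishedInputsAtThree → LargeFamilyInputsF2 → GenericMembersLargeF2 → SelmerThreeAverageLargeF2 → RootNumberPlusLowerDensityLargeF2 → SchneiderOnDoorSubfamily → PAdicBSDRankTwoPositiveProportion

-- `CountingBridgeLoc` holds: proved by `Summit.BirchSwinnertonDyer.BirchSwinnertonDyer.Theorems.countingBridgeLoc` (its module imports this route file, so no `_holds` link can be stated here).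

/-- item stmt-BirchSwinnertonDyer-19684 · aside · rank 9 · open · by planner
why it might fail: non-vanishing mod p of p-adic L-values is known in twist/anticyclotomic families (Vatsal) but not in F₂; only empirical (eng LAMBDA5: λ₅-bad ≈ 20 %)
sources: MazurTateTeitelbaum1986Invent, SteinWuthrich2013
[aside] D-λ(5) analytic statement (banked, NOT staffed; director-bsd CD RULING 13:01:20Z (4)): in
every large congruence subfamily of F₂ with nonempty residue sets, a positive lower density of
members have a globally minimal model, good ordinary at 5, whose 5-adic L-function at every attached
weight-two newform has unit coefficient in degree 2 (‖[T²]L₅(f,α;T)‖₅ = 1 ⇔ μ = 0 ∧ λ = 2). With the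
landed λ-door kernel (Theorems.lambdaDoor_of_norm_coeff_padicLFunction_of_irreducible, p ≥ 5),
Mazur–Tate 1983 integrality and a door family at 5 it would give the BSD(5) rank clause in rank 2
for a positive proportion — a different lever from Selmer counting, with no known line (not weaker
than counting Sel₅, not in print). why it might fail: non-vanishing mod p of p-adic L-values is
known in twist/anticyclotomic families (Vatsal) but not in F₂; the measured λ₅-bad proportion ≈ 20 %
(eng LAMBDA5) says positive density is plausible, not provable. sources:
MazurTateTeitelbaum1986Invent, SteinWuthrich2013, Vatsal1999, eng LAMBDA5.md -/
@[route_item "route-BirchSwinnertonDyer-CountingDoorF2AtThree"]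
def UnitCoefficientDensityAtFive : Prop :=
  ∀ Φ : Literature.NumberTheory.EllipticCurves.BhargavaHo2022.CongruenceFamily₂, Φ.IsLarge → (∀ p : ℕ, p.Prime → (Φ.residues p).Nonempty) → Φ.HasPositiveLowerDensityOn fun a ↦ a.IsMember ∧ ∃ (C : WeierstrassCurve.VariableChange ℚ) (hC : (C • a.curve).IsGloballyMinimal), @Literature.NumberTheory.EllipticCurves.IsOrdinaryAt (C • a.curve) hC 5 _ ∧ ∀ ⦃N : ℕ⦄ [NeZero N] (f : CuspForm (CongruenceSubgroup.Gamma0 N) 2), Literature.NumberTheory.EllipticCurves.ModularForms.IsNewformOf (C • a.curve) f → ‖PowerSeries.coeff 2 (Literature.NumberTheory.EllipticCurves.padicLFunction f (@Literature.NumberTheory.EllipticCurves.unitRoot (C • a.curve) hC 5 _ : ℚ_[5]))‖ = 1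

/-- item stmt-BirchSwinnertonDyer-20019 · support · rank 9 · closed · proved by Summit.BirchSwinnertonDyer.BirchSwinnertonDyer.Theorems.countingBridgeMin (prover) · by planner
[support] the MINIMAL counting bridge: the published inputs at 3, I1 and I2 alone imply the leaf —
large-family inputs (BH22 Thm 10.1/9.1), generic members and Schneider-at-3 are discharged
MEMBER-WISE on eng-2 refined door family Φ*** (reduction homomorphism mod 3·7·13 decided by kernel,
sieve classes at 9, 25, 7, 13, I4loc height digits): tree theorems p482692
intModel_exists_reductionHom, p483480 memberwise genericity, p484012
exists_refinedDoorFamily_densities + leaf_of_cruxes_without_largeFamilyInputs. Closes by the 3-line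
file `theorem countingBridgeMin : CountingBridgeMin := leaf_of_cruxes_without_largeFamilyInputs`
(eng-2 / any prover). why it might fail: it cannot — provable now from landed theorems. sources:
BhargavaHo2022, MazurSteinTate2006, tree p482692 p483480 p484012 -/
@[route_item "route-BirchSwinnertonDyer-CountingDoorF2AtThree", crux]
def CountingBridgeMin : Prop :=
  PublishedInputsAtThree → SelmerThreeAverageLargeF2 → RootNumberPlusLowerDensityLargeF2 → PAdicBSDRankTwoPositiveProportion

-- `CountingBridgeMin` holds: proved by `Summit.BirchSwinnertonDyer.BirchSwinnertonDyer.Theorems.countingBridgeMin` (its module imports this route file, so no `_holds` link can be stated here).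

-- earlier Assembly (stmt-BirchSwinnertonDyer-19447, replaced 2026-08-26T11:34:19Z -> stmt-BirchSwinnertonDyer-19610): retired by None — SelmerThreeAverageLargeF2 → RootNumberPlusLowerDensityLargeF2 → SchneiderDensityOneAtThree → PAdicBSDRankTwoPositiveProportion
/-- item stmt-BirchSwinnertonDyer-19610 · assembly · rank 1 · closed · proved by Summit.BirchSwinnertonDyer.BirchSwinnertonDyer.Theorems.countingDoorF2AtThree_assembly_proof (prover) · by planner
sources: BhargavaHo2022, SkinnerUrban2014
[assembly] published inputs at 3 → large-family inputs (BH22) → I1 (avg #Sel₃ ≤ 36 on large Φ) → I2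
(w=+1 lower density > 1/6) → I4 (Schneider density one at 3 on rank-2 members) → leaf
PAdicBSDRankTwoPositiveProportion; the three support items DoorKernelAtThree / GenericMembersLargeF2
/ CountingBridge are proved (p431831/p435551/p435552), so this join is eng's
leaf_of_cruxes_of_inputs (p437529). -/
@[route_item "route-BirchSwinnertonDyer-CountingDoorF2AtThree"]
def Assembly : Prop :=
  PublishedInputsAtThree → LargeFamilyInputsF2 → SelmerThreeAverageLargeF2 → RootNumberPlusLowerDensityLargeF2 → SchneiderDensityOneAtThree → PAdicBSDRankTwoPositiveProportion

-- `Assembly` holds: proved by `Summit.BirchSwinnertonDyer.BirchSwinnertonDyer.Theorems.countingDoorF2AtThree_assembly_proof` (its module imports this route file, so no `_holds` link can be stated here).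

attribute [summit_statement] _root_.Summit.BirchSwinnertonDyer.BirchSwinnertonDyer.Theses.CountingDoorF2AtThree.PAdicBSDRankTwoPositiveProportion

/-! D-0027 §2.1 — DECIDING THEOREM (planner-authored via `route open/edit --closes-file`; by planner-bsd-rank2-p2-g13-0 2026-08-27T01:48:31Z):
its hypotheses are this route's items and its conclusion the registered leaf `Summit.BirchSwinnertonDyer.BirchSwinnertonDyer.Theses.CountingDoorF2AtThree.PAdicBSDRankTwoPositiveProportion` (rung T-r2, D-0061) (glue_lint), and it elaborates with this file. -/

@[closes "route-BirchSwinnertonDyer-CountingDoorF2AtThree"] theorem closes (hB : CountingBridgeMin) (hIn : PublishedInputsAtThree)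
    (h1 : SelmerThreeAverageLargeF2) (h2 : RootNumberPlusLowerDensityLargeF2) :
    PAdicBSDRankTwoPositiveProportion :=
  hB hIn h1 h2

end Summit.BirchSwinnertonDyer.BirchSwinnertonDyer.Theses.CountingDoorF2AtThree
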